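import Literature.Probability.Percolation.TwoClusterExchange
import Summits.CriticalPhenomena.PercolationContinuityZ3.Theorems.PercNearOneGluingNoHeavyLowerTailWorstPairExchange
import HarnessLib

/-!
# `NoHeavyLowerTail` (stmt-CriticalPhenomena-4575) — exchange rows with a RANDOM CORE ("floating sink")

Support file (prover `prim-lf-1`, lemma factory #1: coupling / BK–Reimer; `--supports stmt-CriticalPhenomena-4575`).
No definitions, no named facts, no sorries.

The sink calculus of the k-cluster line (`Theorems.worstPairExchange_two`, `OwnDisconnection.diamond`,
`Theorems.worstFirst_two_mul`, …) compares clusters against a fixed sink vertex `c` through the literals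
`{x ↔ c}` / `{x ↮ c}`.  In the `(|A|, j) = (5, 2)` cell of the crux the sink is the GIANT — a random cluster.
Pinning the giant to a prescribed CORE `R` (a finite vertex set that must be internally connected) gives the
"floating sink" rows of the seat memo `run/shared/lean/prim/prim-lf-1/CANDIDATES.md` (batch 1).  The basic
observation of this file: for `r₀ ∈ R`,

  `{R internally connected} ∩ {y ∈ C_R} = ⋂_{r ∈ R} {y ↔ r}`      (`core_iff`),

an INCREASING event determined by the cluster of `y`, i.e. a literal of type `(−)` for the pair `(s, t) = (x, y)`
and of type `(+)` for `(s, t) = (y, x)` in the sense of `Literature.….twoClusterExchange` (van den Berg–Häggström–Kahn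
2006, Thm 1.5).  Hence every sink row whose core literals can all be written as "the core lies in the cluster of a
named relay" transfers verbatim to a random core:

* `coreDiamond` (RC0 of the memo) — the random-core version of `OwnDisconnection.diamond`:
  `μ(x↮y, o↔x, R ⊆ C_y) · μ(x↮y, R ⊆ C_x) ≤ μ(x↮y, o↔x, R ⊆ C_x) · μ(x↮y, R ⊆ C_y)`,
  i.e. `P(o ↔ x | x ∉ C_R ∋ y) ≤ P(o ↔ x | y ∉ C_R ∋ x)` on `{R internally connected}`;
* `corePair_inBlock` (piece (1) of RC1) — the block of the random-core pair exchange `S_a S_b ≤ T_a T_b` in which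
  each floating relay's cluster swallows the core in the factor where the other one carries `o`:
  `μ(a↮b, R ⊆ C_a, o↔b) · μ(a↮b, o↔a, R ⊆ C_b) ≤ μ(a↮b, R ⊆ C_a, o↔a) · μ(a↮b, o↔b, R ⊆ C_b)`;
* `corePairExchange_of_pieces` — the real-number bookkeeping `RC1 ⟸ (1) ∧ (2) ∧ CROSS` of the memo (batch 1,
  RC1a): with `S_• = S_•^in + S_•^out`, `T_a = T_a^{b∈} + T_a^{b∉}`, `T_b = T_b^{a∈} + T_b^{a∉}`.

What does NOT transfer (memo, RC−, exact witness `n = 6`): the own-disconnection inequality M₂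
(`ownDisconnection_le`), whose proof uses BHK Thm 1.4 for the pair (relay, SINK) — with a random core the sink
is not a vertex.  The remaining block CROSS of RC1 mixes a two-cluster factor with a three-cluster factor
(core in a third cluster) and is the open residual (0 violations in the seat's census; ttrl request
`random-core-exchange-family`).
-/

noncomputable section

namespace Summit.CriticalPhenomena.PercolationContinuityZ3.Theorems

open MeasureTheory Set Literature.Probability.LatticeModels Literature.Probability.Percolation
open scoped Classical BigOperators

namespace CoreExchange

variable {V : Type*}

/-! ### The core literal `R ⊆ C_s` -/

/-- `ω ∈ ⋂_{r ∈ R} {s ↔ r}` iff every core vertex is joined to `s`. [folklore] -/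
theorem mem_core_iff (s : V) (R : Finset V) (ω : BondConfig V) :
    ω ∈ (⋂ r ∈ R, (openConn s r : Set (BondConfig V))) ↔ ∀ r ∈ R, (openGraph ω).Reachable s r := by
  simp only [mem_iInter]
  rfl

/-- **The core literal.**  For `r₀ ∈ R`: "`R` is internally connected and `s` lies in the core cluster"
(`∀ r r' ∈ R, r ↔ r'` and `s ↔ r₀`) iff `R ⊆ C_s` (`∀ r ∈ R, s ↔ r`). [folklore] -/
theorem core_iff {s r₀ : V} {R : Finset V} (hr₀ : r₀ ∈ R) (ω : BondConfig V) :
    ((∀ r ∈ R, ∀ r' ∈ R, (openGraph ω).Reachable r r') ∧ (openGraph ω).Reachable s r₀) ↔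
      ∀ r ∈ R, (openGraph ω).Reachable s r := by
  constructor
  · rintro ⟨hR, hs⟩ r hr
    exact hs.trans (hR r₀ hr₀ r hr)
  · intro h
    exact ⟨fun r hr r' hr' => (h r hr).symm.trans (h r' hr'), h r₀ hr₀⟩

/-- On `{R ⊆ C_s}`, "`t` is not in the core cluster" is `{s ↮ t}`: for `r₀ ∈ R`,
`(∀ r ∈ R, s ↔ r) → (¬ t ↔ r₀ ↔ ¬ s ↔ t)`. [folklore] -/
theorem not_core_iff {s t r₀ : V} {R : Finset V} (hr₀ : r₀ ∈ R) (ω : BondConfig V)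
    (h : ∀ r ∈ R, (openGraph ω).Reachable s r) :
    ¬ (openGraph ω).Reachable t r₀ ↔ ¬ (openGraph ω).Reachable s t := by
  constructor
  · intro ht hst
    exact ht (hst.symm.trans (h r₀ hr₀))
  · intro hst htr
    exact hst ((h r₀ hr₀).trans htr.symm)

/-! ### Types of the core literal -/

/-- `⋂_{r ∈ R} {s ↔ r}` is of type `(+)` for the pair `(s, t)`. [folklore] -/
theorem typePlus_core (s t : V) (R : Finset V) ⦃ω ω' : BondConfig V⦄
    (hs : openEdgeCluster ω s ⊆ openEdgeCluster ω' s) (ht : openEdgeCluster ω' t ⊆ openEdgeCluster ω t)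
    (h : ω ∈ (⋂ r ∈ R, (openConn s r : Set (BondConfig V)))) :
    ω' ∈ (⋂ r ∈ R, (openConn s r : Set (BondConfig V))) := by
  simp only [mem_iInter] at h ⊢
  exact fun r hr => typePlus_openConn s t r hs ht (h r hr)

/-- `⋂_{r ∈ R} {t ↔ r}` is of type `(−)` for the pair `(s, t)`. [folklore] -/
theorem typeMinus_core (s t : V) (R : Finset V) ⦃ω ω' : BondConfig V⦄
    (hs : openEdgeCluster ω' s ⊆ openEdgeCluster ω s) (ht : openEdgeCluster ω t ⊆ openEdgeCluster ω' t)
    (h : ω ∈ (⋂ r ∈ R, (openConn t r : Set (BondConfig V)))) :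
    ω' ∈ (⋂ r ∈ R, (openConn t r : Set (BondConfig V))) := by
  simp only [mem_iInter] at h ⊢
  exact fun r hr => typeMinus_openConn s t r hs ht (h r hr)

variable [Fintype V]

/-! ### RC0: the core diamond -/

/-- **Core diamond (RC0).**  For `x ≠ y`, an observer `o` and a core `R`:
`μ(x↮y ∩ o↔x ∩ R⊆C_y) · μ(x↮y ∩ R⊆C_x) ≤ μ(x↮y ∩ o↔x ∩ R⊆C_x) · μ(x↮y ∩ R⊆C_y)`.
With `R = {c}` this is `OwnDisconnection.diamond`'s `μ(o↔x | x↮c, y↔c) ≤ μ(o↔x | x↔c, y↮c)`.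
One instance of the two-cluster exchange, `s = x`, `t = y`, `A₁ = {x↔o}`, `B₁ = {R ⊆ C_y}`, `A₂ = {R ⊆ C_x}`,
`B₂ = Ω`. [cite: VandenbergHaggstromKahn2005, Thm. 1.5 (p. 7) — corollary via `twoClusterExchange`] -/
theorem coreDiamond (w : Sym2 V → unitInterval) {x y : V} (hxy : x ≠ y) (o : V) (R : Finset V) :
    (prodBernoulli w).real ((openConn x y)ᶜ ∩
        ((openConn x o : Set (BondConfig V)) ∩ ⋂ r ∈ R, (openConn y r : Set (BondConfig V)))) *
      (prodBernoulli w).real ((openConn x y)ᶜ ∩ ⋂ r ∈ R, (openConn x r : Set (BondConfig V))) ≤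
    (prodBernoulli w).real ((openConn x y)ᶜ ∩
        ((openConn x o : Set (BondConfig V)) ∩ ⋂ r ∈ R, (openConn x r : Set (BondConfig V)))) *
      (prodBernoulli w).real ((openConn x y)ᶜ ∩ ⋂ r ∈ R, (openConn y r : Set (BondConfig V))) := by
  have hex := twoClusterExchange w hxy
    (A₁ := (openConn x o : Set (BondConfig V))) (B₁ := ⋂ r ∈ R, (openConn y r : Set (BondConfig V)))
    (A₂ := ⋂ r ∈ R, (openConn x r : Set (BondConfig V))) (B₂ := (univ : Set (BondConfig V)))
    (fun _ _ h1 h2 hω => typePlus_openConn x y o h1 h2 hω)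
    (fun _ _ h1 h2 hω => typePlus_core x y R h1 h2 hω)
    (fun _ _ h1 h2 hω => typeMinus_core x y R h1 h2 hω)
    (fun _ _ _ _ _ => mem_univ _)
  simpa only [inter_univ] using hex

/-! ### RC1, piece (1): both floating relays' "in" blocks -/

/-- **Random-core pair exchange, in-block (piece (1) of RC1).**  For `a ≠ b`, an observer `o` and a core `R`:
`μ(a↮b ∩ R⊆C_a ∩ b↔o) · μ(a↮b ∩ a↔o ∩ R⊆C_b) ≤ μ(a↮b ∩ R⊆C_a ∩ a↔o) · μ(a↮b ∩ b↔o ∩ R⊆C_b)`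
("if in one copy `a` swallows the core while `o` rides on `b`, and in the other copy the roles are reversed,
then exchanging `o` is favourable").  Since `{a↮b, R⊆C_a, a↔o} ⊆ {o↮b, b∉C_R, a∈C_R}` etc., the right side is
at most `T_b^{a∈} · T_a^{b∈}` of the memo.  One instance of the two-cluster exchange, `s = a`, `t = b`,
`A₁ = {R⊆C_a}`, `B₁ = {b↔o}`, `A₂ = {a↔o}`, `B₂ = {R⊆C_b}`.
[cite: VandenbergHaggstromKahn2005, Thm. 1.5 (p. 7) — corollary via `twoClusterExchange`] -/
theorem corePair_inBlock (w : Sym2 V → unitInterval) {a b : V} (hab : a ≠ b) (o : V) (R : Finset V) :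
    (prodBernoulli w).real ((openConn a b)ᶜ ∩
        ((⋂ r ∈ R, (openConn a r : Set (BondConfig V))) ∩ (openConn b o : Set (BondConfig V)))) *
      (prodBernoulli w).real ((openConn a b)ᶜ ∩
        ((openConn a o : Set (BondConfig V)) ∩ ⋂ r ∈ R, (openConn b r : Set (BondConfig V)))) ≤
    (prodBernoulli w).real ((openConn a b)ᶜ ∩
        ((⋂ r ∈ R, (openConn a r : Set (BondConfig V))) ∩ (openConn a o : Set (BondConfig V)))) *
      (prodBernoulli w).real ((openConn a b)ᶜ ∩
        ((openConn b o : Set (BondConfig V)) ∩ ⋂ r ∈ R, (openConn b r : Set (BondConfig V)))) :=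
  twoClusterExchange w hab
    (A₁ := ⋂ r ∈ R, (openConn a r : Set (BondConfig V))) (B₁ := (openConn b o : Set (BondConfig V)))
    (A₂ := (openConn a o : Set (BondConfig V))) (B₂ := ⋂ r ∈ R, (openConn b r : Set (BondConfig V)))
    (fun _ _ h1 h2 hω => typePlus_core a b R h1 h2 hω)
    (fun _ _ h1 h2 hω => typePlus_openConn a b o h1 h2 hω)
    (fun _ _ h1 h2 hω => typeMinus_openConn a b o h1 h2 hω)
    (fun _ _ h1 h2 hω => typeMinus_core a b R h1 h2 hω)

/-! ### RC1 ⟸ pieces: the bookkeeping -/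

/-- **RC1 from its pieces (real-number bookkeeping).**  If `S_a = S_a^i + S_a^o`, `S_b = S_b^i + S_b^o`,
`T_a = T_a^i + T_a^o`, `T_b = T_b^i + T_b^o` (superscripts: the OTHER floating relay in / out of the core
cluster), and (1) `S_a^i S_b^i ≤ T_a^i T_b^i`, (2) `S_a^o S_b^o ≤ T_a^o T_b^o`,
(CROSS) `S_a^i S_b^o + S_a^o S_b^i ≤ T_a^o T_b^i + T_a^i T_b^o`, then `S_a S_b ≤ T_a T_b`. [this file] -/
theorem corePairExchange_of_pieces {Sa Sb Ta Tb Sai Sao Sbi Sbo Tai Tao Tbi Tbo : ℝ}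
    (hSa : Sa = Sai + Sao) (hSb : Sb = Sbi + Sbo) (hTa : Ta = Tai + Tao) (hTb : Tb = Tbi + Tbo)
    (h1 : Sai * Sbi ≤ Tai * Tbi) (h2 : Sao * Sbo ≤ Tao * Tbo)
    (hcross : Sai * Sbo + Sao * Sbi ≤ Tao * Tbi + Tai * Tbo) :
    Sa * Sb ≤ Ta * Tb := by
  rw [hSa, hSb, hTa, hTb]
  nlinarith [h1, h2, hcross]



/-! ### Floating-sink event gluing and worst-first packing for two relays, from the core pair exchange RC1

The sink bookkeeping of `Theorems.WorstPairExchange` (`exit_subset`, `split_disconnection`,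
`exit_le_of_pocket_le`) and of `Theorems.worstFirst_two_mul`, carried out INSIDE an arbitrary ambient event `Γ`.
With `Γ = ⋂_{r ∈ R} {c ↔ r}` for an anchor `c ∈ R` one has `Γ ∩ {x ↮ c} = {R internally connected, x ∉ C_R}`
(`core_iff`, `not_core_iff`), so the statements below are exactly "RC1 ⟹ REG₂" and "RC1 ⟹ RWF₂" of the seat memo
(random-core event gluing / worst-first packing for two floating relays and an arbitrary core); with `Γ = univ`
they are the sink statements.  Nothing here uses any property of `Γ`. -/

section FloatingSink

variable {n : ℕ}

/-- Splitting the `Γ`-exit event at a relay `x`: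
`Γ ∩ {o ↮ c} ∩ ⋃_{y ∈ A} {o ↔ y} ⊆ (Γ ∩ {o ↔ x} ∩ {x ↮ c}) ∪ (Γ ∩ {o ↮ x} ∩ {o ↮ c} ∩ ⋃_{y ∈ A ∖ x} {o ↔ y})`. [folklore] -/
theorem exit_subset_within (Γ : Set (BondConfig (Fin n))) (A : Finset (Fin n)) (o c x : Fin n) :
    (Γ ∩ (openConn o c : Set (BondConfig (Fin n)))ᶜ ∩ ⋃ y ∈ A, openConn o y) ⊆
      (Γ ∩ (openConn o x : Set (BondConfig (Fin n))) ∩ (openConn x c)ᶜ) ∪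
        (Γ ∩ (openConn o x : Set (BondConfig (Fin n)))ᶜ ∩ (openConn o c)ᶜ ∩ ⋃ y ∈ A.erase x, openConn o y) := by
  intro ω hω
  rcases hω with ⟨⟨hΓ, hoc⟩, hU⟩
  simp only [mem_iUnion, exists_prop] at hU
  obtain ⟨y, hyA, hoy⟩ := hU
  by_cases hox : ω ∈ (openConn o x : Set (BondConfig (Fin n)))
  · left
    refine ⟨⟨hΓ, hox⟩, ?_⟩
    intro hxc
    exact hoc (SimpleGraph.Reachable.trans (show (openGraph ω).Reachable o x from hox) hxc)
  · right
    refine ⟨⟨⟨hΓ, hox⟩, hoc⟩, ?_⟩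
    simp only [mem_iUnion, exists_prop]
    have hyx : y ≠ x := by
      rintro rfl
      exact hox hoy
    exact ⟨y, Finset.mem_erase.2 ⟨hyx, hyA⟩, hoy⟩

/-- `μ(Γ ∩ {o ↔ x} ∩ {x ↮ c}) + μ(Γ ∩ {o ↮ x} ∩ {x ↮ c}) = μ(Γ ∩ {x ↮ c})`. [folklore] -/
theorem split_disconnection_within (w : Sym2 (Fin n) → unitInterval) (Γ : Set (BondConfig (Fin n)))
    (o c x : Fin n) :
    (prodBernoulli w).real (Γ ∩ (openConn o x : Set (BondConfig (Fin n))) ∩ (openConn x c)ᶜ) +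
        (prodBernoulli w).real (Γ ∩ (openConn o x : Set (BondConfig (Fin n)))ᶜ ∩ (openConn x c)ᶜ) =
      (prodBernoulli w).real (Γ ∩ (openConn x c : Set (BondConfig (Fin n)))ᶜ) := by
  rw [← measureReal_union (Set.disjoint_left.2 fun ω h1 h2 => h2.1.2 h1.1.2) MeasurableSet.of_discrete]
  congr 1
  ext ω
  simp only [mem_union, mem_inter_iff, mem_compl_iff]
  tauto

/-- Three-way split of `Γ ∩ {x ↮ c}` by the pocket of `o` (two floating relays `x ≠ y`):
`μ(Γ ∩ {x↮c}) = μ(Γ ∩ {o↮x} ∩ {x↮c}) + μ(Γ ∩ {o↔x} ∩ {o↮y} ∩ {o↮c}) + μ(Γ ∩ {o↔x} ∩ {o↔y} ∩ {o↮c})`,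
i.e. `d_x = T_x + S_y + J`. [folklore] -/
theorem disconnection_split₃_within (w : Sym2 (Fin n) → unitInterval) (Γ : Set (BondConfig (Fin n)))
    (o c x y : Fin n) :
    (prodBernoulli w).real (Γ ∩ (openConn x c : Set (BondConfig (Fin n)))ᶜ) =
      (prodBernoulli w).real (Γ ∩ (openConn o x : Set (BondConfig (Fin n)))ᶜ ∩ (openConn x c)ᶜ) +
      (prodBernoulli w).real (Γ ∩ (openConn o x : Set (BondConfig (Fin n))) ∩ (openConn o y)ᶜ ∩ (openConn o c)ᶜ) +
      (prodBernoulli w).real (Γ ∩ (openConn o x : Set (BondConfig (Fin n))) ∩ openConn o y ∩ (openConn o c)ᶜ) := by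
  have h1 := split_disconnection_within w Γ o c x
  -- split `Γ ∩ {o↔x} ∩ {x↮c}` by `o ↔ y`; on `{o ↔ x}`, `x ↮ c ↔ o ↮ c`
  have h2 : (prodBernoulli w).real (Γ ∩ (openConn o x : Set (BondConfig (Fin n))) ∩ (openConn x c)ᶜ) =
      (prodBernoulli w).real (Γ ∩ (openConn o x : Set (BondConfig (Fin n))) ∩ (openConn o y)ᶜ ∩ (openConn o c)ᶜ) +
      (prodBernoulli w).real (Γ ∩ (openConn o x : Set (BondConfig (Fin n))) ∩ openConn o y ∩ (openConn o c)ᶜ) := by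
    rw [← measureReal_union (Set.disjoint_left.2 fun ω h1 h2 => h1.1.2 h2.1.2) MeasurableSet.of_discrete]
    congr 1
    ext ω
    simp only [mem_union, mem_inter_iff, mem_compl_iff, openConn, mem_setOf_eq]
    constructor
    · rintro ⟨⟨hΓ, hox⟩, hxc⟩
      have hoc : ¬ (openGraph ω).Reachable o c := fun h => hxc (hox.symm.trans h)
      by_cases hoy : (openGraph ω).Reachable o y
      · exact Or.inr ⟨⟨⟨hΓ, hox⟩, hoy⟩, hoc⟩
      · exact Or.inl ⟨⟨⟨hΓ, hox⟩, hoy⟩, hoc⟩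
    · rintro (⟨⟨⟨hΓ, hox⟩, _⟩, hoc⟩ | ⟨⟨⟨hΓ, hox⟩, _⟩, hoc⟩)
      · exact ⟨⟨hΓ, hox⟩, fun h => hoc (hox.trans h)⟩
      · exact ⟨⟨hΓ, hox⟩, fun h => hoc (hox.trans h)⟩
  linarith

/-- **Bookkeeping inside `Γ`**: if `μ(Γ ∩ {x ↮ c}) ≤ s` and `S_x ≤ T_x` (pocket avoiding `x` ≤ `{o↮x, x↮c}`,
both inside `Γ`), then the `Γ`-exit event has probability `≤ s`. [folklore] -/
theorem exit_le_of_pocket_le_within (w : Sym2 (Fin n) → unitInterval) (Γ : Set (BondConfig (Fin n)))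
    (A : Finset (Fin n)) (o c x : Fin n) (s : ℝ)
    (hdx : (prodBernoulli w).real (Γ ∩ (openConn x c : Set (BondConfig (Fin n)))ᶜ) ≤ s)
    (hST : (prodBernoulli w).real
        (Γ ∩ (openConn o x : Set (BondConfig (Fin n)))ᶜ ∩ (openConn o c)ᶜ ∩ ⋃ y ∈ A.erase x, openConn o y) ≤
      (prodBernoulli w).real (Γ ∩ (openConn o x : Set (BondConfig (Fin n)))ᶜ ∩ (openConn x c)ᶜ)) :
    (prodBernoulli w).real (Γ ∩ (openConn o c : Set (BondConfig (Fin n)))ᶜ ∩ ⋃ y ∈ A, openConn o y) ≤ s := by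
  calc (prodBernoulli w).real (Γ ∩ (openConn o c : Set (BondConfig (Fin n)))ᶜ ∩ ⋃ y ∈ A, openConn o y)
      ≤ (prodBernoulli w).real ((Γ ∩ (openConn o x : Set (BondConfig (Fin n))) ∩ (openConn x c)ᶜ) ∪
          (Γ ∩ (openConn o x : Set (BondConfig (Fin n)))ᶜ ∩ (openConn o c)ᶜ ∩ ⋃ y ∈ A.erase x, openConn o y)) :=
        measureReal_mono (exit_subset_within Γ A o c x)
    _ ≤ (prodBernoulli w).real (Γ ∩ (openConn o x : Set (BondConfig (Fin n))) ∩ (openConn x c)ᶜ) +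
          (prodBernoulli w).real
            (Γ ∩ (openConn o x : Set (BondConfig (Fin n)))ᶜ ∩ (openConn o c)ᶜ ∩ ⋃ y ∈ A.erase x, openConn o y) :=
        measureReal_union_le _ _
    _ ≤ (prodBernoulli w).real (Γ ∩ (openConn o x : Set (BondConfig (Fin n))) ∩ (openConn x c)ᶜ) +
          (prodBernoulli w).real (Γ ∩ (openConn o x : Set (BondConfig (Fin n)))ᶜ ∩ (openConn x c)ᶜ) := by
        linarith
    _ = (prodBernoulli w).real (Γ ∩ (openConn x c : Set (BondConfig (Fin n)))ᶜ) :=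
        split_disconnection_within w Γ o c x
    _ ≤ s := hdx

/-- The pocket of `o` avoiding `a`, with relay set `{a, b}`, is `Γ ∩ {o↮a} ∩ {o↮c} ∩ {o↔b}`. [folklore] -/
theorem pocket_pair_eq (Γ : Set (BondConfig (Fin n))) (o c a b : Fin n) (hab : a ≠ b) :
    (Γ ∩ (openConn o a : Set (BondConfig (Fin n)))ᶜ ∩ (openConn o c)ᶜ ∩
        ⋃ y ∈ ({a, b} : Finset (Fin n)).erase a, openConn o y) =
      (Γ ∩ (openConn o a : Set (BondConfig (Fin n)))ᶜ ∩ (openConn o c)ᶜ ∩ openConn o b) := by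
  have hea : ({a, b} : Finset (Fin n)).erase a = {b} := by
    ext x
    simp only [Finset.mem_erase, Finset.mem_insert, Finset.mem_singleton]
    constructor
    · rintro ⟨hxa, hx | hx⟩
      · exact absurd hx hxa
      · exact hx
    · rintro rfl
      exact ⟨fun h => hab h.symm, Or.inr rfl⟩
  rw [hea]; simp only [Finset.mem_singleton, Set.iUnion_iUnion_eq_left]

/-- **Floating-sink event gluing for two relays from the core pair exchange (REG₂ ⟸ RC1).**  Inside any ambient
event `Γ`: if `S_a · S_b ≤ T_a · T_b` with `S_a = μ(Γ ∩ {o↮a} ∩ {o↮c} ∩ {o↔b})`, `T_a = μ(Γ ∩ {o↮a} ∩ {a↮c})`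
(and symmetrically), and both `μ(Γ ∩ {a↮c})`, `μ(Γ ∩ {b↮c}) ≤ s`, then `μ(Γ ∩ {o↮c} ∩ ({o↔a} ∪ {o↔b})) ≤ s`.
With `Γ = ⋂_{r∈R}{c↔r}` this is event gluing with the sink replaced by the random core `R` (memo RC2, `k' = 2`);
with `Γ = univ` and `worstPairExchange_two` it is `Theorems.eventGluing_pair`. [this file] -/
theorem eventGluing_pair_within (w : Sym2 (Fin n) → unitInterval) (Γ : Set (BondConfig (Fin n)))
    (o c a b : Fin n) (hab : a ≠ b) (s : ℝ)
    (hRC1 : (prodBernoulli w).real (Γ ∩ (openConn o a : Set (BondConfig (Fin n)))ᶜ ∩ (openConn o c)ᶜ ∩ openConn o b) *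
        (prodBernoulli w).real (Γ ∩ (openConn o b : Set (BondConfig (Fin n)))ᶜ ∩ (openConn o c)ᶜ ∩ openConn o a) ≤
      (prodBernoulli w).real (Γ ∩ (openConn o a : Set (BondConfig (Fin n)))ᶜ ∩ (openConn a c)ᶜ) *
        (prodBernoulli w).real (Γ ∩ (openConn o b : Set (BondConfig (Fin n)))ᶜ ∩ (openConn b c)ᶜ))
    (ha : (prodBernoulli w).real (Γ ∩ (openConn a c : Set (BondConfig (Fin n)))ᶜ) ≤ s)
    (hb : (prodBernoulli w).real (Γ ∩ (openConn b c : Set (BondConfig (Fin n)))ᶜ) ≤ s) :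
    (prodBernoulli w).real (Γ ∩ (openConn o c : Set (BondConfig (Fin n)))ᶜ ∩ ⋃ y ∈ ({a, b} : Finset (Fin n)),
      openConn o y) ≤ s := by
  have e1 := pocket_pair_eq Γ o c a b hab
  have e2 := pocket_pair_eq Γ o c b a (Ne.symm hab)
  have hpair : ({b, a} : Finset (Fin n)) = {a, b} := Finset.pair_comm b a
  rw [hpair] at e2
  rw [← e1, ← e2] at hRC1
  rcases WorstPairExchange.le_or_le_of_mul_le_mul measureReal_nonneg measureReal_nonneg hRC1 with h | h
  · exact exit_le_of_pocket_le_within w Γ {a, b} o c a s ha h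
  · exact exit_le_of_pocket_le_within w Γ {a, b} o c b s hb h

/-- Real-number core of `worstFirst_two_mul` inside `Γ`: from `d_a = T_a + S_b + J`, `d_b = T_b + S_a + J`,
`d_b ≤ d_a`, `S_a S_b ≤ T_a T_b` and nonnegativity, `d_a · S_a ≤ d_b · T_a`.  Proof: the product inequality gives
`S_a ≤ T_a` or `S_b ≤ T_b`, and the latter also forces `S_a ≤ T_a` through `d_b ≤ d_a`; then
`d_b T_a − d_a S_a = (T_a T_b − S_a S_b) + J (T_a − S_a) ≥ 0`. [this file] -/
theorem worstFirst_two_real {Sa Sb Ta Tb J da db : ℝ} (_hSa : 0 ≤ Sa) (_hSb : 0 ≤ Sb) (hTa : 0 ≤ Ta)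
    (hTb : 0 ≤ Tb) (hJ : 0 ≤ J) (hda : da = Ta + Sb + J) (hdb : db = Tb + Sa + J) (hle : db ≤ da)
    (hprod : Sa * Sb ≤ Ta * Tb) : da * Sa ≤ db * Ta := by
  have hST : Sa ≤ Ta := by
    rcases WorstPairExchange.le_or_le_of_mul_le_mul hTa hTb hprod with h | h
    · exact h
    · linarith
  rw [hda, hdb]
  nlinarith [mul_nonneg hJ (sub_nonneg.2 hST)]

/-- **Floating-sink worst-first packing for two relays from the core pair exchange (RWF₂ ⟸ RC1).**  Inside any
ambient event `Γ`, for distinct relays `a, b` with `μ(Γ ∩ {b↮c}) ≤ μ(Γ ∩ {a↮c})` (`a` the worse) and the core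
pair exchange `S_a S_b ≤ T_a T_b` (as in `eventGluing_pair_within`):
`μ(Γ ∩ {a↮c}) · μ(Γ ∩ {o↔b} ∩ {o↮a} ∩ {o↮c}) ≤ μ(Γ ∩ {b↮c}) · μ(Γ ∩ {o↮a} ∩ {a↮c})`,
which is `Σ_x μ(top = x, Γ-exit)/d_x ≤ 1` for `{a, b}` (cf. `Theorems.worstFirst_two_mul`, the case `Γ = univ`). [this file] -/
theorem worstFirst_two_mul_within (w : Sym2 (Fin n) → unitInterval) (Γ : Set (BondConfig (Fin n)))
    (o c a b : Fin n)
    (hworse : (prodBernoulli w).real (Γ ∩ (openConn b c : Set (BondConfig (Fin n)))ᶜ) ≤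
      (prodBernoulli w).real (Γ ∩ (openConn a c : Set (BondConfig (Fin n)))ᶜ))
    (hRC1 : (prodBernoulli w).real (Γ ∩ (openConn o a : Set (BondConfig (Fin n)))ᶜ ∩ (openConn o c)ᶜ ∩ openConn o b) *
        (prodBernoulli w).real (Γ ∩ (openConn o b : Set (BondConfig (Fin n)))ᶜ ∩ (openConn o c)ᶜ ∩ openConn o a) ≤
      (prodBernoulli w).real (Γ ∩ (openConn o a : Set (BondConfig (Fin n)))ᶜ ∩ (openConn a c)ᶜ) *
        (prodBernoulli w).real (Γ ∩ (openConn o b : Set (BondConfig (Fin n)))ᶜ ∩ (openConn b c)ᶜ)) :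
    (prodBernoulli w).real (Γ ∩ (openConn a c : Set (BondConfig (Fin n)))ᶜ) *
        (prodBernoulli w).real (Γ ∩ (openConn o a : Set (BondConfig (Fin n)))ᶜ ∩ (openConn o c)ᶜ ∩ openConn o b) ≤
      (prodBernoulli w).real (Γ ∩ (openConn b c : Set (BondConfig (Fin n)))ᶜ) *
        (prodBernoulli w).real (Γ ∩ (openConn o a : Set (BondConfig (Fin n)))ᶜ ∩ (openConn a c)ᶜ) := by
  -- the pocket events, rewritten in the order used by the three-way split
  have eSa : (Γ ∩ (openConn o a : Set (BondConfig (Fin n)))ᶜ ∩ (openConn o c)ᶜ ∩ openConn o b) =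
      (Γ ∩ (openConn o b : Set (BondConfig (Fin n))) ∩ (openConn o a)ᶜ ∩ (openConn o c)ᶜ) := by
    ext ω; simp only [mem_inter_iff, mem_compl_iff]; tauto
  have eSb : (Γ ∩ (openConn o b : Set (BondConfig (Fin n)))ᶜ ∩ (openConn o c)ᶜ ∩ openConn o a) =
      (Γ ∩ (openConn o a : Set (BondConfig (Fin n))) ∩ (openConn o b)ᶜ ∩ (openConn o c)ᶜ) := by
    ext ω; simp only [mem_inter_iff, mem_compl_iff]; tauto
  have eJ : (Γ ∩ (openConn o b : Set (BondConfig (Fin n))) ∩ openConn o a ∩ (openConn o c)ᶜ) =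
      (Γ ∩ (openConn o a : Set (BondConfig (Fin n))) ∩ openConn o b ∩ (openConn o c)ᶜ) := by
    ext ω; simp only [mem_inter_iff, mem_compl_iff]; tauto
  have hda := disconnection_split₃_within w Γ o c a b
  have hdb := disconnection_split₃_within w Γ o c b a
  rw [eJ] at hdb
  rw [eSa] at hRC1 ⊢
  rw [eSb] at hRC1
  exact worstFirst_two_real measureReal_nonneg measureReal_nonneg measureReal_nonneg measureReal_nonneg
    measureReal_nonneg hda hdb hworse hRC1

end FloatingSink
end CoreExchange

end Summit.CriticalPhenomena.PercolationContinuityZ3.Theorems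

end
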